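/-
Copyright (c) 2026 the pub-hodgecm-mathlib formalisation cell (harness21).  Prover seat hodgecm-mathlib-K2E1-p16 (g3), Track B ∕ K2-LIT, h413 = `stmt-HodgeConjecture-24833`,
R90-TF section S8 «ContSpec-n½», socket B MID :358 ∕ (V) OF RECORD ED. 3 (★ `R90S8ResGMidBlockNeBotOfRecordV3U3`): PAYER of the visible ledger letter `hEcinv` — left-`G(F)`-invariance
of a continued Eisenstein family at EVERY non-candidate point `z ∉ P` (not only on the slit half-plane of ★ p863205), by the identity theorem on the CONNECTED complement of the closed
co-discrete candidate pole set.
-/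
import Summits.HodgeConjecture.HodgeConjecture.Theorems.R90S8MidWitnessExportsU3Defs        -- ★ (K2E1-p15): `midWitnessEc ∕ midWitnessP`, `midWitnessExports_spec`; brings ★ p863205 `R90S8ResGMidAtomArchStableU3` (automorphy on the tube), ★ pair spaces
import Summits.HodgeConjecture.HodgeConjecture.Theorems.K2E1ConvexDiffCountableConnected    -- ★ (K2E4 lineage): `countable_of_codiscrete`, `isPreconnected_convex_diff_of_countable`
import Mathlib.Analysis.Analytic.Uniqueness                                                  -- Mathlib: `AnalyticOnNhd.eqOn_of_preconnected_of_eventuallyEq` (identity theorem)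
import HarnessLib

/-!
# Left-`G(F)`-invariance of a continued Eisenstein family OFF ITS CANDIDATE POLE SET (the `hEcinv` letter of the (V) OF RECORD ED. 3)

Track B ∕ K2-LIT, crux h413 = `stmt-HodgeConjecture-24833`, route of record `HCCMUnconditional`; cell `hodgecm-mathlib`, R90-TF programme, section S8 «ContSpec-n½», socket B MID :358
∕ (V).  THEOREMS ONLY (no `def`, no `instance`, no `notation`, no named-fact hypothesis, no `sorry`; default heartbeats); lane `--supports stmt-HodgeConjecture-24833 --as helper`
(count-neutral).  CLOSES NO SOCKET.

★ p863205 `midContinuation_quotientSubgroup_mul` propagates the automorphy `E(φ_z)(γ·g) = E(φ_z)(g)` (`2 < Re z`, ★ `eisensteinSeriesU_flatSectionU_rational_mul`) to the SLIT half-plane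
`{1 < Re} ∖ Sp` only.  The (V) OF RECORD ED. 3 (★ `resGMidBlock_ne_bot_of_record_v3`) binds the stronger letter of ★ p864057's currency,
`hEcinv : ∀ z ∉ P, ∀ γ ∈ G(F), ∀ x, Ẽ z (γ·x) = Ẽ z x` at EVERY non-candidate point.  This file pays it:
* §1 (generic, `ℂ`): the complement of a co-discrete set is preconnected (★ `countable_of_codiscrete` + ★ `isPreconnected_convex_diff_of_countable` with `C := univ`); a co-discrete
  set misses points of every right half-plane; the IDENTITY THEOREM OFF A CLOSED CO-DISCRETE SET: two functions analytic at every `z ∉ P` that agree on a right half-plane agree on `ℂ ∖ P`.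
* §2 (CM₃): for continuation data `(Ec, P)` of a pair section `φ` (`P` closed co-discrete, `Ec · g` analytic off `P`, `Ec z = E(φ_z)` on `2 < Re z`): `Ec z (γ·g) = Ec z g` for all `z ∉ P`,
  `γ ∈ A_G·G(F) = G(F)`; and THE INSTANCE for the NAMED twisted witness family `midWitnessEc·Θ` off `midWitnessP` (clauses 7, 8, 16, 19, 20 of ★ `midWitnessExports_spec`) — literally
  the binder `hEcinv` of ★ `resGMidBlock_ne_bot_of_record_v3` (there at the level of record, an instance of the general level data here).

## References
* [MoeglinWaldspurger1995] C. Mœglin, J.-L. Waldspurger, *Spectral Decomposition and Eisenstein Series* (1995), II.1.5 (automorphy of Eisenstein series), IV.1.8–IV.1.11 (continuation).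
* [Conway1978] J. B. Conway, *Functions of One Complex Variable I*, 2nd ed. (1978), IV §3 Thm 3.7 (identity theorem on a region).
-/

set_option autoImplicit false
set_option linter.dupNamespace false  -- the mandated `Summit.HodgeConjecture.HodgeConjecture.…` prefix repeats the summit's segment

noncomputable section

open MeasureTheory Measure Filter Topology Set NumberField IsDedekindDomain
open scoped NNReal ENNReal MatrixGroups
open Literature.MeasureTheory.Group Literature.NumberTheory Literature.NumberTheory.Automorphic Literature.NumberTheory.Automorphic.UnitaryGroup AdelicGroupData
open Literature.NumberTheory.Automorphic.Arthur2013.Leaves.TECR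
open Literature.NumberTheory.GaloisRepresentations (HeckeCharacter)
open Summit.HodgeConjecture.HodgeConjecture.Cruxes.H413.K2E1BorelEisensteinU
open Summit.HodgeConjecture.HodgeConjecture.Cruxes.H413.K2E1BLBorelSpacesU2Defs
open Summit.HodgeConjecture.HodgeConjecture.Cruxes.H413.K2E1BLBorelOperatorsU2Defs
open Summit.HodgeConjecture.HodgeConjecture.Cruxes.H413.K2E1CharacterEisensteinU2Defs
open Summit.HodgeConjecture.HodgeConjecture.Cruxes.H413.K2E1ChiSectionSpaceU2Defs
open Summit.HodgeConjecture.HodgeConjecture.Cruxes.H413.K2E1CharacterEisensteinU3PairDefs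
open Summit.HodgeConjecture.HodgeConjecture.Cruxes.H413.K2E1ChiSectionSpaceU3PairDefs
open Summit.HodgeConjecture.HodgeConjecture.Cruxes.H413.K2E1ConvexDiffCountableConnected (countable_of_codiscrete isPreconnected_convex_diff_of_countable)
open Summit.HodgeConjecture.HodgeConjecture.R90.S8

namespace Summit.HodgeConjecture.HodgeConjecture.Cruxes.H413.K2E1ChiEisensteinLeftInvarianceOffPolesCMThree

/-! ## §1 Generic: the identity theorem off a closed co-discrete subset of `ℂ` -/

section Generic

/-- **The complement of a co-discrete subset of `ℂ` is preconnected**: a co-discrete set is countable (★ `countable_of_codiscrete`, Lindelöf), and the complement of a countable set in a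
real vector space of rank `> 1` is (path-)connected (★ `isPreconnected_convex_diff_of_countable` with the convex open `univ`). [cite: Conway1978, IV §3 Thm 3.7] -/
theorem isPreconnected_compl_of_codiscrete {P : Set ℂ} (hPcd : ∀ z₀ : ℂ, ∀ᶠ s in 𝓝[≠] z₀, s ∉ P) : IsPreconnected Pᶜ := by
  rw [Set.compl_eq_univ_sdiff]
  exact isPreconnected_convex_diff_of_countable Literature.Topology.Euclidean.one_lt_rank_real_complex convex_univ isOpen_univ (countable_of_codiscrete hPcd)

/-- **A co-discrete set misses points of every open right half-plane**: for every real `b` there is `z ∉ P` with `b < Re z` (the punctured neighbourhood filter of `b + 1` is non-trivial).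
[cite: Conway1978, IV §3 Thm 3.7] -/
theorem exists_re_gt_notMem_of_codiscrete {P : Set ℂ} (hPcd : ∀ z₀ : ℂ, ∀ᶠ s in 𝓝[≠] z₀, s ∉ P) (b : ℝ) : ∃ z : ℂ, b < z.re ∧ z ∉ P := by
  have hopen : ∀ᶠ s in 𝓝[≠] ((b : ℂ) + 1), b < s.re :=
    eventually_nhdsWithin_of_eventually_nhds (((isOpen_lt continuous_const Complex.continuous_re).mem_nhds (by simp)))
  exact (hopen.and (hPcd _)).exists

/-- **THE IDENTITY THEOREM OFF A CLOSED CO-DISCRETE SET**: if `u`, `v : ℂ → ℂ` are analytic at every point outside a co-discrete `P ⊆ ℂ` and agree on an open right half-plane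
`{b < Re}`, then they agree at EVERY `z ∉ P` (the complement is preconnected, §1, and contains a point of the half-plane around which `u = v`). [cite: Conway1978, IV §3 Thm 3.7] -/
theorem eqOn_compl_of_codiscrete_of_eqOn_re_gt {P : Set ℂ} (hPcd : ∀ z₀ : ℂ, ∀ᶠ s in 𝓝[≠] z₀, s ∉ P) {u v : ℂ → ℂ}
    (hu : ∀ z : ℂ, z ∉ P → AnalyticAt ℂ u z) (hv : ∀ z : ℂ, z ∉ P → AnalyticAt ℂ v z) {b : ℝ} (h : ∀ z : ℂ, b < z.re → u z = v z) :
    EqOn u v Pᶜ := by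
  obtain ⟨z₀, hz₀, hz₀P⟩ := exists_re_gt_notMem_of_codiscrete hPcd b
  have huA : AnalyticOnNhd ℂ u Pᶜ := fun z hz => hu z hz
  have hvA : AnalyticOnNhd ℂ v Pᶜ := fun z hz => hv z hz
  refine huA.eqOn_of_preconnected_of_eventuallyEq hvA (isPreconnected_compl_of_codiscrete hPcd) hz₀P ?_
  exact Filter.eventually_of_mem ((isOpen_lt continuous_const Complex.continuous_re).mem_nhds hz₀) fun z hz => h z hz

/-- Pointwise form of §1's identity theorem: `u z = v z` for every `z ∉ P`. [cite: Conway1978, IV §3 Thm 3.7] -/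
theorem eq_of_codiscrete_of_eqOn_re_gt {P : Set ℂ} (hPcd : ∀ z₀ : ℂ, ∀ᶠ s in 𝓝[≠] z₀, s ∉ P) {u v : ℂ → ℂ}
    (hu : ∀ z : ℂ, z ∉ P → AnalyticAt ℂ u z) (hv : ∀ z : ℂ, z ∉ P → AnalyticAt ℂ v z) {b : ℝ} (h : ∀ z : ℂ, b < z.re → u z = v z) {z : ℂ} (hz : z ∉ P) :
    u z = v z :=
  eqOn_compl_of_codiscrete_of_eqOn_re_gt hPcd hu hv h hz

end Generic

/-! ## §2 CM₃: left-`G(F)`-invariance of continuation data off the candidate pole set, and the instance for the named witness family -/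

section CM

variable (L : Type) [Field L] [NumberField L] [IsCMField L]
  [MeasurableSpace (quasiSplit (↥(maximalRealSubfield L)) L (IsCMField.complexConj L) 3).Adelic] [BorelSpace (quasiSplit (↥(maximalRealSubfield L)) L (IsCMField.complexConj L) 3).Adelic]
  [MeasurableSpace (arch (↥(maximalRealSubfield L)) L (IsCMField.complexConj L) 3 ((StdForm.antidiagonal 3).over L))] [BorelSpace (arch (↥(maximalRealSubfield L)) L (IsCMField.complexConj L) 3 ((StdForm.antidiagonal 3).over L))]
  [MeasurableSpace (finAdelic (↥(maximalRealSubfield L)) L (IsCMField.complexConj L) 3 ((StdForm.antidiagonal 3).over L))] [BorelSpace (finAdelic (↥(maximalRealSubfield L)) L (IsCMField.complexConj L) 3 ((StdForm.antidiagonal 3).over L))]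

omit [MeasurableSpace (quasiSplit (↥(maximalRealSubfield L)) L (IsCMField.complexConj L) 3).Adelic] [BorelSpace (quasiSplit (↥(maximalRealSubfield L)) L (IsCMField.complexConj L) 3).Adelic]
  [MeasurableSpace (arch (↥(maximalRealSubfield L)) L (IsCMField.complexConj L) 3 ((StdForm.antidiagonal 3).over L))] [BorelSpace (arch (↥(maximalRealSubfield L)) L (IsCMField.complexConj L) 3 ((StdForm.antidiagonal 3).over L))]
  [MeasurableSpace (finAdelic (↥(maximalRealSubfield L)) L (IsCMField.complexConj L) 3 ((StdForm.antidiagonal 3).over L))] [BorelSpace (finAdelic (↥(maximalRealSubfield L)) L (IsCMField.complexConj L) 3 ((StdForm.antidiagonal 3).over L))] in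
/-- **LEFT-`A_G·G(F)`-INVARIANCE OF CONTINUATION DATA OFF THE CANDIDATE POLE SET**: for a pair section `φ` of `(χ₁, χ₂)` with `χ₂` automorphic and continuation data `(Ec, P)` — `P`
co-discrete, `Ec · g` analytic at every `z ∉ P`, `Ec z = E(flatSectionU φ z)` for `2 < Re z` — one has `Ec z (γ·g) = Ec z g` for every `z ∉ P`, `γ ∈ A_G·G(F)`, `g`: on `{2 < Re}` this is the automorphy of
the series (★ `eisensteinSeriesU_flatSectionU_rational_mul`, ★ `quotientSubgroup_quasiSplit`), and §1 propagates it to `ℂ ∖ P`. [cite: MoeglinWaldspurger1995, II.1.5, IV.1.11] [cite: Conway1978, IV §3 Thm 3.7] -/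
theorem continuation_quotientSubgroup_mul_of_codiscrete {χ₁ : HeckeCharacter L} {χ₂ : ↥(TorusDict.torus (IsCMField.complexConj L)) →ₜ* ℂˣ}
    {φ : (quasiSplit (↥(maximalRealSubfield L)) L (IsCMField.complexConj L) 3).Adelic → ℂ} (hφ : IsChiSectionPair χ₁ χ₂ φ) (hχ₂ : TorusDict.IsAutomorphic (IsCMField.complexConj L) χ₂)
    {Ec : ℂ → (quasiSplit (↥(maximalRealSubfield L)) L (IsCMField.complexConj L) 3).Adelic → ℂ} {P : Set ℂ} (hPcd : ∀ z₀ : ℂ, ∀ᶠ s in 𝓝[≠] z₀, s ∉ P)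
    (hEan : ∀ g (z : ℂ), z ∉ P → AnalyticAt ℂ (fun z => Ec z g) z) (hE2 : ∀ z : ℂ, 2 < z.re → Ec z = eisensteinSeriesU (flatSectionU φ z))
    {γ : (quasiSplit (↥(maximalRealSubfield L)) L (IsCMField.complexConj L) 3).Adelic} (hγ : γ ∈ (quasiSplit (↥(maximalRealSubfield L)) L (IsCMField.complexConj L) 3).quotientSubgroup) (g : (quasiSplit (↥(maximalRealSubfield L)) L (IsCMField.complexConj L) 3).Adelic) {z : ℂ} (hz : z ∉ P) :
    Ec z (γ * g) = Ec z g := by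
  -- automorphy of the Borel Eisenstein series of the flat sections of `φ` (`φ` is left-`B(F)`-invariant)
  have hinv : ∀ w : ℂ, eisensteinSeriesU (flatSectionU φ w) (γ * g) = eisensteinSeriesU (flatSectionU φ w) g := fun w => by
    have hγ' := hγ
    rw [quotientSubgroup_quasiSplit] at hγ'
    obtain ⟨γ₀, hγ₀⟩ := MonoidHom.mem_range.1 hγ'
    rw [← hγ₀]
    exact eisensteinSeriesU_flatSectionU_rational_mul (hφ.toAdelic_mul hχ₂) w γ₀ g
  refine eq_of_codiscrete_of_eqOn_re_gt hPcd (u := fun w => Ec w (γ * g)) (v := fun w => Ec w g) (hEan (γ * g)) (hEan g) (b := 2) (fun w hw => ?_) hz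
  show Ec w (γ * g) = Ec w g
  rw [hE2 w hw]
  exact hinv w

omit [MeasurableSpace (quasiSplit (↥(maximalRealSubfield L)) L (IsCMField.complexConj L) 3).Adelic] [BorelSpace (quasiSplit (↥(maximalRealSubfield L)) L (IsCMField.complexConj L) 3).Adelic]
  [MeasurableSpace (arch (↥(maximalRealSubfield L)) L (IsCMField.complexConj L) 3 ((StdForm.antidiagonal 3).over L))] [BorelSpace (arch (↥(maximalRealSubfield L)) L (IsCMField.complexConj L) 3 ((StdForm.antidiagonal 3).over L))]
  [MeasurableSpace (finAdelic (↥(maximalRealSubfield L)) L (IsCMField.complexConj L) 3 ((StdForm.antidiagonal 3).over L))] [BorelSpace (finAdelic (↥(maximalRealSubfield L)) L (IsCMField.complexConj L) 3 ((StdForm.antidiagonal 3).over L))] in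
/-- **`hEcinv` OF LETTERS (★ p864057's currency)**: with the data of `continuation_quotientSubgroup_mul_of_codiscrete`, `∀ z ∉ P, ∀ γ : G(F) (arithmetic subgroup), ∀ x, Ec z (γ·x) = Ec z x`
(`G(F) ≤ A_G·G(F)`). [cite: MoeglinWaldspurger1995, II.1.5, IV.1.11] -/
theorem hEcinv_of_codiscrete {χ₁ : HeckeCharacter L} {χ₂ : ↥(TorusDict.torus (IsCMField.complexConj L)) →ₜ* ℂˣ}
    {φ : (quasiSplit (↥(maximalRealSubfield L)) L (IsCMField.complexConj L) 3).Adelic → ℂ} (hφ : IsChiSectionPair χ₁ χ₂ φ) (hχ₂ : TorusDict.IsAutomorphic (IsCMField.complexConj L) χ₂)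
    {Ec : ℂ → (quasiSplit (↥(maximalRealSubfield L)) L (IsCMField.complexConj L) 3).Adelic → ℂ} {P : Set ℂ} (hPcd : ∀ z₀ : ℂ, ∀ᶠ s in 𝓝[≠] z₀, s ∉ P)
    (hEan : ∀ g (z : ℂ), z ∉ P → AnalyticAt ℂ (fun z => Ec z g) z) (hE2 : ∀ z : ℂ, 2 < z.re → Ec z = eisensteinSeriesU (flatSectionU φ z)) :
    ∀ z : ℂ, z ∉ P → ∀ (γ : (quasiSplit (↥(maximalRealSubfield L)) L (IsCMField.complexConj L) 3).arithmeticSubgroup) (x : (quasiSplit (↥(maximalRealSubfield L)) L (IsCMField.complexConj L) 3).Adelic), Ec z ((γ : (quasiSplit (↥(maximalRealSubfield L)) L (IsCMField.complexConj L) 3).Adelic) * x) = Ec z x := fun _ hz γ x =>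
  continuation_quotientSubgroup_mul_of_codiscrete L hφ hχ₂ hPcd hEan hE2 ((quasiSplit (↥(maximalRealSubfield L)) L (IsCMField.complexConj L) 3).arithmeticSubgroup_le_quotientSubgroup γ.2) x hz

/-- **THE INSTANCE: the `hEcinv` letter of ★ `resGMidBlock_ne_bot_of_record_v3` for the NAMED twisted witness family** — `∀ z ∉ midWitnessP, ∀ γ ∈ G(F), ∀ x,
(midWitnessEc z (γ x))·Θ(γ x) = (midWitnessEc z x)·Θ(x)` (`Θ = detChar ψ`), from ★ `midWitnessExports_spec`: co-discreteness of `midWitnessP` (clause 8), the twisted pair block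
`φ·Θ ∈ V(χ·ψ̃⁻¹, 1·ψ; K′, ω·Θ)` (clause 16; `1·ψ` automorphic since `ψ` is), the tube identity `Ẽ z = E((φ·Θ)_z)` on `2 < Re z` (clause 19) and analyticity off `midWitnessP` (clause 20).
[cite: MoeglinWaldspurger1995, II.1.5, IV.1.11] [cite: Conway1978, IV §3 Thm 3.7] -/
theorem hEcinv_midWitness_twist
    (μ : Measure (quasiSplit (↥(maximalRealSubfield L)) L (IsCMField.complexConj L) 3).automorphicQuotient) [(quasiSplit (↥(maximalRealSubfield L)) L (IsCMField.complexConj L) 3).IsAutomorphicMeasure μ]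
    (νG : Measure (quasiSplit (↥(maximalRealSubfield L)) L (IsCMField.complexConj L) 3).Adelic) [νG.IsHaarMeasure] [νG.IsInvInvariant] [SFinite νG]
    (ν : Measure ↥(adelicUnipotent (↥(maximalRealSubfield L)) L (IsCMField.complexConj L) 3)) [ν.IsHaarMeasure] [ν.IsMulRightInvariant] [ν.IsInvInvariant]
    {𝓕 : Set ↥(adelicUnipotent (↥(maximalRealSubfield L)) L (IsCMField.complexConj L) 3)}
    (h𝓕N : IsFundamentalDomain ↥(rationalUnipotent (↥(maximalRealSubfield L)) L (IsCMField.complexConj L) 3) 𝓕 ν) (h𝓕c : IsCompact (closure 𝓕)) (h𝓕₀ : ν 𝓕 ≠ 0)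
    {β : (quasiSplit (↥(maximalRealSubfield L)) L (IsCMField.complexConj L) 3).Adelic → ℝ≥0∞}
    (hβ : IsCoveringWeight ↥((arithmeticBorel (↥(maximalRealSubfield L)) L (IsCMField.complexConj L) 3).map (quasiSplit (↥(maximalRealSubfield L)) L (IsCMField.complexConj L) 3).arithmeticSubgroup.subtype) β)
    {μZ : Measure (borelQuotient (↥(maximalRealSubfield L)) L (IsCMField.complexConj L) 3)} [SFinite μZ]
    (hμZ : ∀ f : borelQuotient (↥(maximalRealSubfield L)) L (IsCMField.complexConj L) 3 → ℝ≥0∞, Measurable f → ∫⁻ z, f z ∂μZ = ∫⁻ g, β g * f (toBorelQuotient (↥(maximalRealSubfield L)) L (IsCMField.complexConj L) 3 g) ∂νG)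
    -- the M1 family: `φ ∈ V(χ, K, 1)` continuous bounded with `φ ∘ ι_∞ = φ(1)`, and a basis of `V(χʷ, K, 1)` by continuous bounded functions
    {χ : HeckeCharacter L} {K' : Subgroup (quasiSplit (↥(maximalRealSubfield L)) L (IsCMField.complexConj L) 3).Adelic} {ω : ↥K' → ℂ} {φ : (quasiSplit (↥(maximalRealSubfield L)) L (IsCMField.complexConj L) 3).Adelic → ℂ} (hφV : φ ∈ chiSectionSpace χ K' ω) (hφc : Continuous φ) {Mφ : ℝ} (hφM : ∀ x, ‖φ x‖ ≤ Mφ)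
    -- the LEVEL: `K′ ≤ K`, `ι(K_∞) ⊆ K′`, an open compact `U₀` with `ι_f(U₀ ∩ G_f) ⊆ K′` on which `ω = 1`, continuity of the sections; auxiliary Haar measures on `G_∞` (two-sided) and `G(𝔸_f)`
    (hK' : K' ≤ ((standardMaximalCompactGL 3 L).comap (adelicVal (↥(maximalRealSubfield L)) L (IsCMField.complexConj L) 3 ((StdForm.antidiagonal 3).over L)) : Subgroup (quasiSplit (↥(maximalRealSubfield L)) L (IsCMField.complexConj L) 3).Adelic))
    (hKinf : ∀ k : arch (↥(maximalRealSubfield L)) L (IsCMField.complexConj L) 3 ((StdForm.antidiagonal 3).over L), adelicVal (↥(maximalRealSubfield L)) L (IsCMField.complexConj L) 3 ((StdForm.antidiagonal 3).over L) (archToAdelic (↥(maximalRealSubfield L)) L (IsCMField.complexConj L) 3 _ k) ∈ standardMaximalCompactGL 3 L →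
      archToAdelic (↥(maximalRealSubfield L)) L (IsCMField.complexConj L) 3 _ k ∈ K')
    (U₀ : Subgroup (GL (Fin 3) (FiniteAdeleRing (𝓞 L) L))) (hU₀o : IsOpen (U₀ : Set (GL (Fin 3) (FiniteAdeleRing (𝓞 L) L)))) (hU₀c : IsCompact (U₀ : Set (GL (Fin 3) (FiniteAdeleRing (𝓞 L) L))))
    (hU : ∀ b : finAdelic (↥(maximalRealSubfield L)) L (IsCMField.complexConj L) 3 ((StdForm.antidiagonal 3).over L), (b : GL (Fin 3) (FiniteAdeleRing (𝓞 L) L)) ∈ U₀ →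
      ∃ hb : finAdelicToAdelic (↥(maximalRealSubfield L)) L (IsCMField.complexConj L) 3 ((StdForm.antidiagonal 3).over L) b ∈ K', ω ⟨_, hb⟩ = 1)
    (hVc : ∀ φ ∈ chiSectionSpace χ K' ω, Continuous φ)
    (μa : Measure (arch (↥(maximalRealSubfield L)) L (IsCMField.complexConj L) 3 ((StdForm.antidiagonal 3).over L))) [μa.IsHaarMeasure] [μa.IsMulRightInvariant]
    (μf : Measure (finAdelic (↥(maximalRealSubfield L)) L (IsCMField.complexConj L) 3 ((StdForm.antidiagonal 3).over L))) [μf.IsHaarMeasure]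
    {ι' : Type} [Fintype ι'] [DecidableEq ι'] (bV : Module.Basis ι' ℂ ↥(chiSectionSpace (reflectChar (IsCMField.complexConj L) χ) K' ω))
    (hbc : ∀ j, Continuous ((bV j : ↥(chiSectionSpace (reflectChar (IsCMField.complexConj L) χ) K' ω)) : (quasiSplit (↥(maximalRealSubfield L)) L (IsCMField.complexConj L) 3).Adelic → ℂ)) {Mb : ℝ} (hbM : ∀ j x, ‖((bV j : ↥(chiSectionSpace (reflectChar (IsCMField.complexConj L) χ) K' ω)) : (quasiSplit (↥(maximalRealSubfield L)) L (IsCMField.complexConj L) 3).Adelic → ℂ) x‖ ≤ Mb)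
    (h2 : Module.finrank (↥(maximalRealSubfield L)) L = 2) (hc : IsCMField.complexConj L ≠ 1) (hJ : ((StdForm.antidiagonal 3).over L).det ≠ 0)
    (ψ : ↥(TorusDict.torus (IsCMField.complexConj L)) →ₜ* ℂˣ) (hψ : TorusDict.IsAutomorphic (IsCMField.complexConj L) ψ) :
    ∀ z : ℂ, z ∉ midWitnessP L μ νG ν h𝓕N h𝓕c h𝓕₀ hβ hμZ hφV hφc hφM hK' hKinf U₀ hU₀o hU₀c hU hVc μa μf bV hbc hbM h2 hc hJ ψ hψ → ∀ (γ : (quasiSplit (↥(maximalRealSubfield L)) L (IsCMField.complexConj L) 3).arithmeticSubgroup) (x : (quasiSplit (↥(maximalRealSubfield L)) L (IsCMField.complexConj L) 3).Adelic),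
      midWitnessEc L μ νG ν h𝓕N h𝓕c h𝓕₀ hβ hμZ hφV hφc hφM hK' hKinf U₀ hU₀o hU₀c hU hVc μa μf bV hbc hbM h2 hc hJ ψ hψ z ((γ : (quasiSplit (↥(maximalRealSubfield L)) L (IsCMField.complexConj L) 3).Adelic) * x) * ((detChar (↥(maximalRealSubfield L)) L (IsCMField.complexConj L) h2 hc 3 ((StdForm.antidiagonal 3).over L) ψ hψ hJ ((γ : (quasiSplit (↥(maximalRealSubfield L)) L (IsCMField.complexConj L) 3).Adelic) * x) : ℂˣ) : ℂ) = midWitnessEc L μ νG ν h𝓕N h𝓕c h𝓕₀ hβ hμZ hφV hφc hφM hK' hKinf U₀ hU₀o hU₀c hU hVc μa μf bV hbc hbM h2 hc hJ ψ hψ z x * ((detChar (↥(maximalRealSubfield L)) L (IsCMField.complexConj L) h2 hc 3 ((StdForm.antidiagonal 3).over L) ψ hψ hJ x : ℂˣ) : ℂ) := by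
  obtain ⟨-, -, -, -, -, -, -, hPcd, -, -, -, -, -, -, -, hmem, -, -, htube, hEanT, -⟩ := midWitnessExports_spec L μ νG ν h𝓕N h𝓕c h𝓕₀ hβ hμZ hφV hφc hφM hK' hKinf U₀ hU₀o hU₀c hU hVc μa μf bV hbc hbM h2 hc hJ ψ hψ
  have h1 : TorusDict.IsAutomorphic (IsCMField.complexConj L) ((1 : ↥(TorusDict.torus (IsCMField.complexConj L)) →ₜ* ℂˣ) * ψ) := by
    rw [show ((1 : ↥(TorusDict.torus (IsCMField.complexConj L)) →ₜ* ℂˣ) * ψ) = ψ from one_mul ψ]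
    exact hψ
  exact hEcinv_of_codiscrete L (Ec := fun z x => midWitnessEc L μ νG ν h𝓕N h𝓕c h𝓕₀ hβ hμZ hφV hφc hφM hK' hKinf U₀ hU₀o hU₀c hU hVc μa μf bV hbc hbM h2 hc hJ ψ hψ z x * ((detChar (↥(maximalRealSubfield L)) L (IsCMField.complexConj L) h2 hc 3 ((StdForm.antidiagonal 3).over L) ψ hψ hJ x : ℂˣ) : ℂ)) (isChiSectionPair_of_mem hmem) h1 hPcd hEanT htube

end CM

end Summit.HodgeConjecture.HodgeConjecture.Cruxes.H413.K2E1ChiEisensteinLeftInvarianceOffPolesCMThree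

end
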